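import Summits.BirchSwinnertonDyer.BirchSwinnertonDyer.Theorems.PrintCFramBottomClassIndexLawFiveLeBorelH1Vanishing
import HarnessLib

/-!
# Route `PrintCFram`, crux C2 `BottomClassIndexLawFiveLe` (stmt-BirchSwinnertonDyer-20372), line
# `eisenstein-resource-bdp-line` (v7 stub S2 `stub_kolyvaginUpper_borelCM`): Gross 1991 Prop. 9.1 /
# McCallum's injectivity of `[x, ·]` IN THE KOLYVAGIN MACHINE'S OWN CURRENCY (`galH1Torsion`,
# `h1Eval`, `torsionFixing`) at the Borel CM-ramified prime, every quadratic `K`, every level `p^M`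
# (cell `bsd-print-cfram`, seat `bsd-line-cfram-p1-w2` g5; helper `--supports` 20372; 0 facts, 0 defs)

HONEST FRAMING. Nothing about BSD is proved here. File 4 of the width seat's (α)-discharge. The
tree's Kolyvagin machine proves Gross's Prop. 9.1 as `KolyvaginPairing.eq_zero_of_h1Eval_eq_zero`
under the hypotheses its printed proof uses — an element `z ∈ Γ_K` acting on `E[n]` as the homothety
`−1` and `2` invertible — both produced from `HasSurjectiveModNGaloisRep` in
`exists_kolyvaginPrime_gt` (Step A, `RatClosure.exists_smul_eq_of_sq`). On the Borel CM-ramified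
class `−1` is in general NOT in the image of `Γ_{K''}` (for the untwisted members an element acting
as the scalar `−1` would commute with `√−p`, but the elements outside `Γ_{ℚ(√−p)}` anti-commute with
it and those inside act through squares). This file records that ANY integer homothety `d` with
`(d − 1, n) = 1` does the same job, and instantiates it on the class:

* §1 `eq_zero_of_h1Eval_eq_zero_of_smul_eq` — GENERIC (any field `K`, any elliptic `E`, `n ≥ 1`):
  `z ∈ Γ_K` acting on `E[n]` as `d` with `(d − 1, n) = 1`, and `[x, ρ] = 0` for all
  `ρ ∈ Γ_{K(E[n])}` ⟹ `x = 0` in `H¹(K, E[n])` (file 1/3 §2 + `Rubin1987.eq_zero_of_forall_h1Eval_eq_zero`);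
  `h1Eval_restrict_injective_of_smul_eq` — `x ↦ [x, ·]|_{Γ_{K(E[n])}}` is injective.
* §2 on the class (`W.HasCM`, `CMRamified W p`, `5 ≤ p`, `[K:ℚ] = 2`, `M ≥ 1`):
  **`eq_zero_of_forall_h1Eval_eq_zero_of_cmRamified`** (Gross Prop. 9.1 / the injectivity input of
  McCallum's (2) `exists_h1Eval_eq_of_indep`, at level `p^M`, with NO image hypothesis) and
  **`h1Eval_restrict_injective_of_cmRamified`**; `eq_zero_of_forall_h1Eval_eq_zero_of_cmRamified_sq`
  — the same at the machine's auxiliary level `n = p^M · p^M` (the level of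
  `KolyvaginDescent.card_sha_primaryComponent_le_of_localTerm`).

What remains image-dependent in `exists_kolyvaginPrime_gt*` after this and w4 g2's (β): the
SIMPLICITY `hS` of `E[p]` (false here: the line `W[𝔭]`) inside Gross's Prop. 9.3
`KolyvaginPairing.eq_top_of_stable_of_indep` — the visibility step (γ). THEOREMS ONLY; no definition,
no named fact, no `sorry`; imports no `Theses` module. BSD is not proved by any of this.
References: [GrossLMS1991] Prop. 9.1, Prop. 9.3; [McCallumLMS1991] §3 (2); [Rubin1999] Lemma 6.2 (i).
-/

set_option autoImplicit false
-- `…BirchSwinnertonDyer.BirchSwinnertonDyer.Theorems…` is the problem's mandated namespace (D-0017).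
set_option linter.dupNamespace false

noncomputable section

open scoped Classical

namespace Summit.BirchSwinnertonDyer.BirchSwinnertonDyer.Theorems.PrintCFram.BorelHomothety

open WeierstrassCurve Field Literature.NumberTheory.EllipticCurves
  Literature.NumberTheory.GaloisRepresentations Literature.NumberTheory.EllipticCurves.Rank1Residual

universe u

/-! ## §1 Gross's Prop. 9.1 with an arbitrary homothety in place of `−1` -/

section Generic

variable {K : Type u} [Field K] (V : WeierstrassCurve K) [V.IsElliptic]

/-- **Gross 1991, Prop. 9.1 with any homothety.** If `z ∈ Γ_K` acts on `E[n]` as an integer `d`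
with `(d − 1, n) = 1` and `[x, ρ] = 0` for every `ρ ∈ Γ_{K(E[n])}`, then `x = 0` in `H¹(K, E[n])`
(the tree's `KolyvaginPairing.eq_zero_of_h1Eval_eq_zero` is the case `d = −1`, `n` odd).
[cite: GrossLMS1991, Prop. 9.1] [cite: Rubin1999, Lemma 6.2 (i)] -/
theorem eq_zero_of_h1Eval_eq_zero_of_smul_eq {n : ℕ} (hn : n ≠ 0) {z : absoluteGaloisGroup K}
    {d : ℤ} (hz : ∀ P : geomTorsion V (n : ℤ), z • P = d • P) (hd : IsCoprime (d - 1) (n : ℤ))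
    {x : galH1Torsion V (n : ℤ)} (hx : ∀ ρ ∈ torsionFixing V (n : ℤ), h1Eval V (n : ℤ) x ρ = 0) :
    x = 0 :=
  Rubin1987.eq_zero_of_forall_h1Eval_eq_zero V (n : ℤ)
    (subgroupResKer_torsionFixing_eq_bot_of_smul_eq V hn hz hd) hx

/-- **Injectivity of `x ↦ [x, ·]|_{Γ_{K(E[n])}}`** under the same homothety hypothesis.
[cite: GrossLMS1991, Prop. 9.1] [cite: Rubin1999, Thm. 6.5 (proof)] -/
theorem h1Eval_restrict_injective_of_smul_eq {n : ℕ} (hn : n ≠ 0) {z : absoluteGaloisGroup K}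
    {d : ℤ} (hz : ∀ P : geomTorsion V (n : ℤ), z • P = d • P) (hd : IsCoprime (d - 1) (n : ℤ)) :
    Function.Injective fun x : galH1Torsion V (n : ℤ) ↦
      fun ρ : torsionFixing V (n : ℤ) ↦ h1Eval V (n : ℤ) x ρ :=
  Rubin1987.h1Eval_restrict_injective V (n : ℤ)
    (subgroupResKer_torsionFixing_eq_bot_of_smul_eq V hn hz hd)

end Generic

/-! ## §2 On the Borel CM-ramified class, every quadratic field, every level -/

section Class

variable (W : WeierstrassCurve ℚ) [W.IsElliptic] (p : ℕ) [hp : Fact p.Prime]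
  (K : Type) [Field K] [NumberField K]

/-- **Gross Prop. 9.1 / McCallum's injectivity on the class at level `p^M`**: for `W/ℚ` with CM and
`p ≥ 5` ramified in the CM field, `K` any quadratic field, `M ≥ 1`, and `x ∈ H¹(K, E[p^M])` with
`[x, ρ] = 0` for all `ρ ∈ Γ_{K(E[p^M])}`: `x = 0`. (`E = W_K`; no image hypothesis — the homothety of
`exists_central_homothety_of_cmRamified` replaces `−1 ∈ ρ̄(Γ_K)`.)
[cite: GrossLMS1991, Prop. 9.1] [cite: McCallumLMS1991, §3 (2)] -/
theorem eq_zero_of_forall_h1Eval_eq_zero_of_cmRamified (hCM : W.HasCM) (h5 : 5 ≤ p)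
    (hram : CMRamified W p) (hK2 : Module.finrank ℚ K = 2) {M : ℕ} (hM : 1 ≤ M)
    {x : galH1Torsion (W.baseChange K) ((p ^ M : ℕ) : ℤ)}
    (hx : ∀ ρ ∈ torsionFixing (W.baseChange K) ((p ^ M : ℕ) : ℤ),
      h1Eval (W.baseChange K) ((p ^ M : ℕ) : ℤ) x ρ = 0) : x = 0 :=
  Rubin1987.eq_zero_of_forall_h1Eval_eq_zero (W.baseChange K) _
    (subgroupResKer_torsionFixing_eq_bot_of_cmRamified W p K hCM h5 hram hK2 hM) hx

/-- **Injectivity of `x ↦ [x, ·]|_{Γ_{K(E[p^M])}}` on `H¹(K, E[p^M])`** on the class, every quadratic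
`K`, every `M ≥ 1`. [cite: GrossLMS1991, Prop. 9.1] -/
theorem h1Eval_restrict_injective_of_cmRamified (hCM : W.HasCM) (h5 : 5 ≤ p) (hram : CMRamified W p)
    (hK2 : Module.finrank ℚ K = 2) {M : ℕ} (hM : 1 ≤ M) :
    Function.Injective fun x : galH1Torsion (W.baseChange K) ((p ^ M : ℕ) : ℤ) ↦
      fun ρ : torsionFixing (W.baseChange K) ((p ^ M : ℕ) : ℤ) ↦
        h1Eval (W.baseChange K) ((p ^ M : ℕ) : ℤ) x ρ :=
  Rubin1987.h1Eval_restrict_injective (W.baseChange K) _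
    (subgroupResKer_torsionFixing_eq_bot_of_cmRamified W p K hCM h5 hram hK2 hM)

/-- **The machine's auxiliary level `p^M · p^M`.** The same statements at `n = p^M · p^M` (the level
`m² = p^{2M₀}` of `KolyvaginDescent.card_sha_primaryComponent_le_of_localTerm`): restriction to
`Γ_{K(E[p^M·p^M])}` is injective on `H¹(K, E[p^M·p^M])`, and `subgroupResKer … = ⊥` there.
[cite: McCallumLMS1991, §1 Theorem and §3 (2)] -/
theorem subgroupResKer_torsionFixing_eq_bot_of_cmRamified_sq (hCM : W.HasCM) (h5 : 5 ≤ p)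
    (hram : CMRamified W p) (hK2 : Module.finrank ℚ K = 2) {M : ℕ} (hM : 1 ≤ M) :
    subgroupResKer (geomTorsion (W.baseChange K) ((p ^ M * p ^ M : ℕ) : ℤ))
        (torsionFixing (W.baseChange K) ((p ^ M * p ^ M : ℕ) : ℤ)) = ⊥ ∧
      ∀ {x : galH1Torsion (W.baseChange K) ((p ^ M * p ^ M : ℕ) : ℤ)},
        (∀ ρ ∈ torsionFixing (W.baseChange K) ((p ^ M * p ^ M : ℕ) : ℤ),
          h1Eval (W.baseChange K) ((p ^ M * p ^ M : ℕ) : ℤ) x ρ = 0) → x = 0 := by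
  have h2M : 1 ≤ M + M := by omega
  have hres := subgroupResKer_torsionFixing_eq_bot_of_cmRamified W p K hCM h5 hram hK2 h2M
  rw [← pow_add] 
  exact ⟨hres, fun hx => Rubin1987.eq_zero_of_forall_h1Eval_eq_zero (W.baseChange K) _ hres hx⟩

end Class

end Summit.BirchSwinnertonDyer.BirchSwinnertonDyer.Theorems.PrintCFram.BorelHomothety

end
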